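import Summits.Ventures.PackingBounds.Configurations.WeightedListConfig

/-!
# A `12`-point code of `ℝ⁴` at cosine exactly `1/4` (rational Gram matrix; the 12-point optimum of S³): `A(4, arccos 1/4) ≥ 12`

Framing: lottery ticket; floor = certified bounds/negative ranges. Venture `PackingBounds` (cell `pub-packcert`, seat
`pub-packcert-recog`, RECOG.md v35 §26 ALG-GRAM). The registered pass polished the cell's numerical optimum of `12` points in
`ℝ⁴` (file results/t5att/res1/best_n4_N12.json; the Hardin–Smith–Sloane putatively optimal 12-point code of S³, minimal angle
`75.5225° = arccos(1/4)`) and found it TIGHT at `1/4` with a RATIONAL five-class Gram matrix (classes `1/4, 1/8, −1/3, −5/8, −3/4`;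
profiles `(6,1,0,3,1) × 8`, `(6,0,3,0,2) × 4`), PSD of rank `4` exactly (two programs). This file is the exact `L·D·Lᵀ` over `ℚ`,
integerised: `rows` = `12` integer rows on the `4` pivot columns, `weights` = integer weights with `Σ_i w_i l_i l'_i = 576 · G_{l l'}`;
`WeightedListConfig.exists_code_weighted` over `ℤ` (`Int.castRingHom ℝ`) turns the `decide`d checks into
**`exists_code_12`: `12` unit vectors of `ℝ⁴` with pairwise inner products `≤ 1/4`**. Optimality is NOT claimed (no certified
upper bound for the cell `(4, 1/4)` is on file at this writing; the seat asks the sdp seat for one: a value `< 13` would make `12` exact).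
-/

namespace Summit.Ventures.PackingBounds.Config.Dim4Card12Quarter

open Summit.Ventures.PackingBounds.Config.Weighted

/-- The `4` integer weights. -/
def weights : List ℤ := [9, 7, 8, 24]
/-- The `12` integer rows (weighted self-product `576` each). -/
def rows : List (List ℤ) := [[8, 0, 0, 0], [-6, -6, 0, 0], [2, -6, 3, -3], [2, -6, 3, 3], [2, 2, 8, 0], [2, -6, -6, 0], [-5, 3, 3, -3], [-5, 3, 3, 3], [1, 9, 0, 0], [-5, 3, -6, 0], [2, 2, -4, 4], [2, 2, -4, -4]]
/-- The admissible weighted products of two distinct rows (`576` times the off-diagonal Gram values `1/4, 1/8, −1/3, −5/8, −3/4`). -/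
def keys : List ℤ := [144, 72, -192, -360, -432]

/-- Kernel check: `12` rows. -/
theorem length_rows : rows.length = 12 := by decide

/-- Kernel check: `4` weights, rows of length `4`, weighted self-products `576`. -/
theorem shape_rows : shapeW weights rows 4 (576 : ℤ) = true := by decide +kernel

/-- Kernel check: every weighted product of two distinct rows is a key. -/
theorem keys_rows : keysW weights rows keys rows = true := by decide +kernel

/-- `576` is not a key. -/
theorem q_not_key : (576 : ℤ) ∉ keys := by decide

/-- **`A(4, arccos 1/4) ≥ 12` (kernel-checked exact object): `12` unit vectors of `ℝ⁴` with pairwise inner products `≤ 1/4`.** -/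
theorem exists_code_12 : ∃ C : Finset (EuclideanSpace ℝ (Fin 4)), C.card = 12 ∧
    (∀ x ∈ C, ‖x‖ = 1) ∧ ∀ x ∈ C, ∀ y ∈ C, x ≠ y → inner ℝ x y ≤ (1 : ℝ) / 4 := by
  obtain ⟨C, hc, h1, h2⟩ := exists_code_weighted (R := ℤ) (ι := Int.castRingHom ℝ) (n := 4)
    (q := (576 : ℤ)) (W := weights) (L := rows) (K := keys) Int.cast_injective (by simp) 
    (by intro w hw; simp only [weights, List.mem_cons, List.not_mem_nil, or_false] at hw
        rcases hw with rfl | rfl | rfl | rfl <;> simp)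
    shape_rows keys_rows q_not_key ((1 : ℝ) / 4)
    (by intro k hk; simp only [keys, List.mem_cons, List.not_mem_nil, or_false] at hk
        rcases hk with rfl | rfl | rfl | rfl | rfl <;> norm_num)
  exact ⟨C, hc.trans (by simp [rows]), h1, h2⟩

end Summit.Ventures.PackingBounds.Config.Dim4Card12Quarter
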